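import Summits.ValiantsHypothesis.ValiantsHypothesis.Theorems.LacunarySymmetroidMatrixDescartesCensusIntervalParityWalls

/-!
# `MatrixDescartes` census — RETURN VISITS ARE EVEN: between two zeros of the SAME node nomial a node-frame pencil has an even
# number of det-roots

HONEST FRAMING.  Object-search cell `pub-symmetroid`, door-A seat `val-sym-door-p3` (g9); item stmt-ValiantsHypothesis-19980
`DoorA34 = PosRootLawAt 3 4 18` (route item `Theses.LacunarySymmetroid.DoorA34`) is OPEN and asserted nowhere in this file.
Corollary of `…CensusIntervalParityWalls.det_walls_parity` (general parity rule between two simple walls) in its most useful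
hypothesis-light form:

* `mul_pos_of_forall_ne_zero` — sign persistence: a continuous real function with no zero on `[t₁, t₂]` has `f(t₁)·f(t₂) > 0`;
* **`even_countP_roots_between_zeros_sameNode`** — for a pencil `S l = ∑ᵢ A i l • vᵢvᵢᵀ` with a frame in general position, if
  `t₁ < t₂` are two zeros of the SAME node nomial `ℓⱼ` and the other three node nomials have no zero on `[t₁, t₂]` (`ℓⱼ` itself
  may vanish in between), then the number of det-roots in `(t₁, t₂)`, counted with multiplicity, is EVEN.  In the chamber language
  of `…NodeChambers`: a RETURN visit (the arc leaves a chamber through the wall it entered by) carries an even number of roots;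
  for a nineteen (all roots simple) an even number of distinct roots.

Nothing here bounds `ζ_sym(3,4)`; `DoorA34` stays OPEN; nothing bears on `MatrixDescartes` (stmt-ValiantsHypothesis-18050) or on
`VP ≠ VNP`.  [folklore] Intermediate value theorem + the parity rule.
-/

-- `Summit.ValiantsHypothesis.ValiantsHypothesis.…` repeats a component by the D-0017 layout
-- (single-conjunct summit), which the `dupNamespace` linter flags; the name is mandated.
set_option linter.dupNamespace false

namespace Summit.ValiantsHypothesis.ValiantsHypothesis.Theorems.LacunarySymmetroidMatrixDescartes.Census

open Finset Polynomial
open scoped BigOperators Matrix Polynomial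

/-- **Sign persistence.**  A continuous `f : ℝ → ℝ` with no zero on `[t₁, t₂]` (`t₁ < t₂`) satisfies `0 < f t₁ * f t₂`. [folklore] -/
theorem mul_pos_of_forall_ne_zero {f : ℝ → ℝ} (hf : Continuous f) {t₁ t₂ : ℝ} (ht : t₁ < t₂)
    (hne : ∀ t ∈ Set.Icc t₁ t₂, f t ≠ 0) : 0 < f t₁ * f t₂ := by
  have h1 : f t₁ ≠ 0 := hne t₁ ⟨le_rfl, ht.le⟩
  have h2 : f t₂ ≠ 0 := hne t₂ ⟨ht.le, le_rfl⟩
  rcases lt_or_gt_of_ne (mul_ne_zero h1 h2) with hlt | hgt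
  · exfalso
    have hcont : ContinuousOn f (Set.Icc t₁ t₂) := hf.continuousOn
    rcases lt_or_gt_of_ne h1 with ha | ha
    · have hb : 0 < f t₂ := by nlinarith
      obtain ⟨r, hr, hfr⟩ := intermediate_value_Ioo ht.le hcont ⟨ha, hb⟩
      exact hne r ⟨hr.1.le, hr.2.le⟩ hfr
    · have hb : f t₂ < 0 := by nlinarith
      obtain ⟨r, hr, hfr⟩ := intermediate_value_Ioo' ht.le hcont ⟨hb, ha⟩
      exact hne r ⟨hr.1.le, hr.2.le⟩ hfr
  · exact hgt

/-- A node nomial `t ↦ ∑ₗ A i l · t^(d l)` is continuous. [folklore] -/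
theorem continuous_nodeNomial {K : ℕ} (d : Fin K → ℕ) (A : Fin 4 → Fin K → ℝ) (i : Fin 4) :
    Continuous fun t : ℝ => ∑ l, A i l * t ^ d l := by
  fun_prop

/-- **RETURN VISITS ARE EVEN.**  Let `S l = ∑ᵢ A i l • vᵢvᵢᵀ` with a frame in general position (every three nodes independent),
and let `t₁ < t₂` be zeros of the SAME node nomial `ℓⱼ` such that the other three node nomials do not vanish on `[t₁, t₂]`.  Then
the number of det-roots of the pencil in `(t₁, t₂)`, counted with multiplicity, is even. [folklore] -/
theorem even_countP_roots_between_zeros_sameNode {K : ℕ} (d : Fin K → ℕ) (A : Fin 4 → Fin K → ℝ)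
    (v : Fin 4 → Fin 3 → ℝ)
    (hgp : ∀ a b c : Fin 4, a ≠ b → b ≠ c → a ≠ c → (Matrix.of ![v a, v b, v c]).det ≠ 0)
    {t₁ t₂ : ℝ} (ht : t₁ < t₂) (j : Fin 4)
    (h₁ : ∑ l, A j l * t₁ ^ d l = 0) (h₂ : ∑ l, A j l * t₂ ^ d l = 0)
    (hother : ∀ i, i ≠ j → ∀ t ∈ Set.Icc t₁ t₂, ∑ l, A i l * t ^ d l ≠ 0)
    (hP : (∑ l, (X : ℝ[X]) ^ d l • (∑ i, A i l • Matrix.vecMulVec (v i) (v i)).map C).det ≠ 0) :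
    Even ((∑ l, (X : ℝ[X]) ^ d l • (∑ i, A i l • Matrix.vecMulVec (v i) (v i)).map C).det.roots.countP
        (fun r => t₁ < r ∧ r < t₂)) := by
  have hσ : ∀ i : Fin 4, i ≠ 3 → Equiv.swap j 3 i ≠ j := by
    intro i hi h
    have : Equiv.swap j 3 (Equiv.swap j 3 i) = Equiv.swap j 3 j := by rw [h]
    rw [Equiv.swap_apply_self, Equiv.swap_apply_left] at this
    exact hi this
  have hne₁ : ∀ i, i ≠ j → ∑ l, A i l * t₁ ^ d l ≠ 0 := fun i hi => hother i hi t₁ ⟨le_rfl, ht.le⟩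
  have hne₂ : ∀ i, i ≠ j → ∑ l, A i l * t₂ ^ d l ≠ 0 := fun i hi => hother i hi t₂ ⟨ht.le, le_rfl⟩
  rw [det_walls_parity d A v hgp ht j j h₁ hne₁ h₂ hne₂ hP]
  -- each of the three other node nomials keeps its sign on [t₁, t₂]
  have p0 := mul_pos_of_forall_ne_zero (continuous_nodeNomial d A (Equiv.swap j 3 0)) ht
    (hother _ (hσ 0 (by decide)))
  have p1 := mul_pos_of_forall_ne_zero (continuous_nodeNomial d A (Equiv.swap j 3 1)) ht
    (hother _ (hσ 1 (by decide)))
  have p2 := mul_pos_of_forall_ne_zero (continuous_nodeNomial d A (Equiv.swap j 3 2)) ht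
    (hother _ (hσ 2 (by decide)))
  have key : (∑ l, A (Equiv.swap j 3 0) l * t₁ ^ d l) * (∑ l, A (Equiv.swap j 3 1) l * t₁ ^ d l)
        * (∑ l, A (Equiv.swap j 3 2) l * t₁ ^ d l) *
      ((∑ l, A (Equiv.swap j 3 0) l * t₂ ^ d l) * (∑ l, A (Equiv.swap j 3 1) l * t₂ ^ d l)
        * (∑ l, A (Equiv.swap j 3 2) l * t₂ ^ d l))
      = ((∑ l, A (Equiv.swap j 3 0) l * t₁ ^ d l) * (∑ l, A (Equiv.swap j 3 0) l * t₂ ^ d l)) *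
        (((∑ l, A (Equiv.swap j 3 1) l * t₁ ^ d l) * (∑ l, A (Equiv.swap j 3 1) l * t₂ ^ d l)) *
          ((∑ l, A (Equiv.swap j 3 2) l * t₁ ^ d l) * (∑ l, A (Equiv.swap j 3 2) l * t₂ ^ d l))) := by ring
  rw [key]
  exact mul_pos p0 (mul_pos p1 p2)

end Summit.ValiantsHypothesis.ValiantsHypothesis.Theorems.LacunarySymmetroidMatrixDescartes.Census
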